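import Literature.MathematicalPhysics.StatisticalMechanics.StickyDiscNonUniqueGroundStates
import Literature.MathematicalPhysics.StatisticalMechanics.TriangularLatticeMaximalDeviation
import HarnessLib

/-!
# De Luca–Friesecke 2017, Theorem 1.1: the classification of particle numbers with unique sticky-disc
minimizer — PROVED (`LucaFriesecke2017_uniqueness_holds`)

Source: L. De Luca, G. Friesecke, *Classification of particle numbers with unique Heitmann–Radin minimizer*,
J. Stat. Phys. 167 (2017) 1586–1592, arXiv:1701.07231 (`paper:arxiv-1701.07231`, chunks p0003 and p0005 read).

**Theorem 1.1 (p0003).** "Let `N ∈ ℕ`. The minimizers of `E_HR` among `N`-particle configurations are unique up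
to translation and rotation if and only if either (a) `N = 3s²+3s+1` for some `s ∈ ℕ ∪ {0}`, or
(b) `N = 3s²+3s+1+(s+1)k+s` for some `s ∈ ℕ ∪ {0}`, `k ∈ {0,1,2,3,4}`."

**Printed proof of 'only if' (§2, p0005).** "for such `N`, the canonical minimizer … has a non-convex angle at the
boundary. … When `k ≤ 2`, we can move the first not yet covered side of the central hexagon on top of the last not
yet covered side … This preserves `μ = 0` and `χ = 1`, and does not change the perimeter, and hence yields another
minimizer. When `k ≥ 3`, we can instead move the first new side … on top of the third covered side … Either way,
the new minimizer is not a rotated translate of the canonical one."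

## What this file does

The named fact `LucaFriesecke2017_uniqueness` (`StickyDiscUniqueGroundStates`) is discharged.  The 'if' half is
the theorem `isUniqueUpToRigidMotion_of_isUniqueParticleNumber` (same file); the 'only if' half was proved in
`StickyDiscNonUniqueGroundStates` for `N ≤ 38` (`uniqueness_iff_of_le_thirtyeight`) and for the families
`3s²+3s+2`, `3s²+3s+1+(s+1)k` (`1 ≤ k ≤ 5`) and `3s²+3s+1+(s+1)k+j` (`k ≤ 4`, `1 ≤ j ≤ s−2`, not `(k,j) = (4,s−2)`),
by exhibiting two maximal contact graphs with different numbers of `2`- or `3`-valent discs.  Here the remaining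
particle numbers — `j = s−1` (`k ≤ 4`), `(k,j) = (4,s−2)`, and `k = 5`, `1 ≤ j ≤ s` — are settled the way the paper
does it: by a SECOND EXPLICIT MINIMIZER obtained by rearranging boundary rows, shown not to be a rotated translate of
the first.  Our pairs are "clipped lattice hexagons" `hexShape X Y σ τ u v` (§1: the lattice hexagon with rows
`0…Y`, columns `0…X`, diagonals `σ…τ`, minus the first `u` labels of the top row and, if `v = 1`, the bottom-right
vertex); both members of a pair have `N` labels and `⌈√(12N−3)⌉` lattice lines, hence (Davoli–Piovano–Stefanelli /
Harborth, `isTriMinimizer_of_lineCount_eq`, `adjCount_le_two_mul_harborthNumber`) exactly `H(N) = ⌊3N − √(12N−3)⌋`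
contacts, i.e. they are Heitmann–Radin minimizers (§2–§3); and they are told apart by the NUMBER OF `5`-VALENT
LABELS (§4: `0` for a full hexagon, `1` with a clipped row, `2` with a clipped row and a clipped vertex), which is
invariant under rigid motions (`not_isUniqueUpToRigidMotion_of_card_filter_ne`, §5).  §6 lists the pairs:

* `not_isUniqueUpToRigidMotion_pred` — `N = 3s²+3s+1+(s+1)k+(s−1)`, `k ≤ 4`, `s ≥ 3`: full unbalanced hexagon vs.
  balanced hexagon minus a vertex;
* `not_isUniqueUpToRigidMotion_pred_pred` — `N = 3s²+3s+1+(s+1)·4+(s−2)`, `s ≥ 3`: hexagon minus a two-label row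
  end vs. hexagon minus a one-label row end and the opposite vertex;
* `not_isUniqueUpToRigidMotion_five` — `N = 3s²+3s+1+(s+1)·5+j`, `1 ≤ j ≤ s`, `s ≥ 3`: `H_{s+1}` minus a row end
  (vs. the full unbalanced hexagon when `j = s`, vs. a shorter row end plus the opposite vertex when `j < s`).

§7 assembles **`LucaFriesecke2017_uniqueness_holds : LucaFriesecke2017_uniqueness`** from these, the families of
`StickyDiscNonUniqueGroundStates`, `uniqueness_iff_of_le_thirtyeight`, and the hexagonal-shell decomposition
`N = 3s²+3s+1+(s+1)k+j` (`k ≤ 5`, `j ≤ s`).  No new named facts; standard axioms.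

## References
* [LucaFriesecke2017] L. De Luca, G. Friesecke, J. Stat. Phys. 167 (2017), Theorem 1.1 (p0003), §2 (p0005).
* [DavoliPiovanoStefanelli2017] E. Davoli, P. Piovano, U. Stefanelli, Proc. R. Soc. Edinburgh 147A (2017), (11)–(12)
  p. 630, Definition 3.2 p. 643 (line count of EIP minimizers).
* [Harborth1974] H. Harborth, Elem. Math. 29 (1974) 14–15 (the contact number `⌊3N − √(12N−3)⌋`).
-/

noncomputable section

open Finset

namespace Literature.MathematicalPhysics.StatisticalMechanics.LucaFriesecke2017

open Literature.Geometry.DiscreteGeometry (harborthNumber adjCount_le_two_mul_harborthNumber)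
open Literature.Geometry.DiscreteGeometry.HarborthSpiral (Adj adjCount ind card_filter_adj rot6 rot6inv
  IsRowConvex lineCount IsTriConvex mem_image_rot6 image_snd_image_rot6 image_snd_image_rot6_rot6)
open DavoliPiovanoStefanelli2017 (isTriMinimizer_of_lineCount_eq isTriMinimizer_image_triPoint_iff)
open Theil2006 (Plane triPoint triPoint_injective)

/-! ## §1 Lattice hexagons with a clipped top row and a clipped vertex -/

/-- **The label set `G(X,Y,σ,τ;u,v)`**: the lattice hexagon `{0 ≤ m ≤ X, 0 ≤ n ≤ Y, σ ≤ m+n ≤ τ}` (rows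
`0…Y`, columns `0…X`, diagonals `σ…τ`), with the first `u` labels `(0,Y),…,(u−1,Y)` of its top row removed
and, if `v ≥ 1`, also its bottom-right vertex `(X,0)` removed.  For `u = v = 0` a full lattice hexagon; the
removed sets are ends of sides, so all lattice lines and 3-convexity are kept (`lineCount_hexShape`,
`isTriConvex_hexShape`). [cite: LucaFriesecke2017, §2 (proof of non-uniqueness) p0005] -/
def hexShape (X Y σ τ u v : ℕ) : Finset (ℤ × ℤ) :=
  ((Icc (0 : ℤ) X) ×ˢ (Icc (0 : ℤ) Y)).filter fun p =>
    (σ : ℤ) ≤ p.1 + p.2 ∧ p.1 + p.2 ≤ τ ∧ ¬(p.2 = Y ∧ p.1 < u) ∧ ¬(1 ≤ v ∧ p.1 = X ∧ p.2 = 0)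

/-- Membership in `G(X,Y,σ,τ;u,v)`. [cite: LucaFriesecke2017, §2 p0005] -/
theorem mem_hexShape {X Y σ τ u v : ℕ} {p : ℤ × ℤ} :
    p ∈ hexShape X Y σ τ u v ↔ (0 ≤ p.1 ∧ p.1 ≤ X) ∧ (0 ≤ p.2 ∧ p.2 ≤ Y) ∧
      ((σ : ℤ) ≤ p.1 + p.2 ∧ p.1 + p.2 ≤ τ ∧ ¬(p.2 = Y ∧ p.1 < u) ∧ ¬(1 ≤ v ∧ p.1 = X ∧ p.2 = 0)) := by
  simp only [hexShape, mem_filter, mem_product, mem_Icc, and_assoc]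

/-- `G(X,Y,σ,τ;u,v)` is 3-convex (the removed labels are ends of lattice lines).
[cite: DavoliPiovanoStefanelli2017, Definition 3.2 p. 643] -/
theorem isTriConvex_hexShape (X Y σ τ u v : ℕ) : IsTriConvex (hexShape X Y σ τ u v) := by
  refine ⟨?_, ?_, ?_⟩
  · intro t a w c ha hc haw hwc
    rw [mem_hexShape] at ha hc ⊢
    dsimp only at ha hc ⊢
    omega
  · intro t a w c ha hc haw hwc
    rw [mem_image_rot6, mem_hexShape] at ha hc ⊢
    simp only [rot6inv] at ha hc ⊢
    omega
  · intro t a w c ha hc haw hwc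
    rw [mem_image_rot6, mem_image_rot6, mem_hexShape] at ha hc ⊢
    simp only [rot6inv] at ha hc ⊢
    omega

/-- The standing size hypotheses on the parameters: a genuine hexagon (`σ + 1 ≤ X, Y`, `X + 1, Y + 1 ≤ τ`,
`τ + 1 ≤ X + Y`), clipped mildly (`u + 1 ≤ X`, `u + Y ≤ τ`), not too small (`2 ≤ X, Y`).
[cite: LucaFriesecke2017, §2 p0005] -/
structure HexParams (X Y σ τ u v : ℕ) : Prop where
  hσX : σ + 1 ≤ X
  hσY : σ + 1 ≤ Y
  hXτ : X + 1 ≤ τ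
  hYτ : Y + 1 ≤ τ
  hτ : τ + 1 ≤ X + Y
  huX : u + 1 ≤ X
  huτ : u + Y ≤ τ
  hX : 2 ≤ X
  hY : 2 ≤ Y
  hv : v ≤ 1

/-- The rows of `G` are `0, …, Y`. [cite: LucaFriesecke2017, §2 p0005] -/
theorem image_snd_hexShape {X Y σ τ u v : ℕ} (h : HexParams X Y σ τ u v) :
    (hexShape X Y σ τ u v).image Prod.snd = Icc (0 : ℤ) Y := by
  obtain ⟨hσX, hσY, hXτ, hYτ, hτ, huX, huτ, hX, hY, hv⟩ := h
  ext n
  rw [mem_Icc]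
  constructor
  · intro hn
    obtain ⟨p, hp, rfl⟩ := mem_image.1 hn
    rw [mem_hexShape] at hp
    omega
  · intro hn
    refine mem_image.2 ⟨(if n < σ then (σ : ℤ) - n else if n = Y then (u : ℤ) else 0, n), ?_, rfl⟩
    rw [mem_hexShape]; dsimp only; split_ifs <;> omega

/-- The columns of `G` are `0, …, X`. [cite: LucaFriesecke2017, §2 p0005] -/
theorem image_fst_hexShape {X Y σ τ u v : ℕ} (h : HexParams X Y σ τ u v) :
    (hexShape X Y σ τ u v).image Prod.fst = Icc (0 : ℤ) X := by
  obtain ⟨hσX, hσY, hXτ, hYτ, hτ, huX, huτ, hX, hY, hv⟩ := h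
  ext m
  rw [mem_Icc]
  constructor
  · intro hm
    obtain ⟨p, hp, rfl⟩ := mem_image.1 hm
    rw [mem_hexShape] at hp
    omega
  · intro hm
    refine mem_image.2 ⟨(m, if m < σ then (σ : ℤ) - m else if m = X then 1 else 0), ?_, rfl⟩
    rw [mem_hexShape]; dsimp only; split_ifs <;> omega

/-- The diagonals `m + n = d` of `G` are `d = σ, …, τ`. [cite: LucaFriesecke2017, §2 p0005] -/
theorem image_sum_hexShape {X Y σ τ u v : ℕ} (h : HexParams X Y σ τ u v) :
    ((hexShape X Y σ τ u v).image fun q => q.1 + q.2) = Icc (σ : ℤ) τ := by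
  obtain ⟨hσX, hσY, hXτ, hYτ, hτ, huX, huτ, hX, hY, hv⟩ := h
  ext d
  rw [mem_Icc]
  constructor
  · intro hd
    obtain ⟨p, hp, rfl⟩ := mem_image.1 hd
    rw [mem_hexShape] at hp
    omega
  · intro hd
    by_cases h1 : d + 1 ≤ X
    · refine mem_image.2 ⟨(d, 0), ?_, by simp⟩
      rw [mem_hexShape]; dsimp only; omega
    · by_cases h2 : d = X
      · refine mem_image.2 ⟨((X : ℤ) - 1, 1), ?_, by dsimp only; omega⟩
        rw [mem_hexShape]; dsimp only; omega
      · refine mem_image.2 ⟨((X : ℤ), d - X), ?_, by dsimp only; omega⟩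
        rw [mem_hexShape]; dsimp only; omega

/-- **`G` meets `(X+1) + (Y+1) + (τ−σ+1)` lattice lines.** [cite: DavoliPiovanoStefanelli2017, (10) p. 630] -/
theorem lineCount_hexShape {X Y σ τ u v : ℕ} (h : HexParams X Y σ τ u v) :
    lineCount (hexShape X Y σ τ u v) = (X + 1) + (Y + 1) + (τ - σ + 1) := by
  have hστ : σ ≤ τ := by have := h.hσX; have := h.hXτ; omega
  unfold lineCount
  rw [image_snd_image_rot6, image_snd_image_rot6_rot6, image_snd_hexShape h, image_sum_hexShape h,
    image_fst_hexShape h]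
  simp only [Int.card_Icc]
  omega

/-! ## §2 Cardinality: box minus two corner triangles, minus the clipped labels -/

/-- The triangle `{(m,n) ∈ ℕ² : m + n < σ}`. [folklore] -/
private def natTri (σ : ℕ) : Finset (ℕ × ℕ) :=
  ((range σ) ×ˢ (range σ)).filter fun p => p.1 + p.2 < σ

/-- Membership in the triangle. [folklore] -/
private theorem mem_natTri {σ : ℕ} {p : ℕ × ℕ} : p ∈ natTri σ ↔ p.1 + p.2 < σ := by
  simp only [natTri, mem_filter, mem_product, mem_range]
  omega

/-- `#{m + n < σ} = σ(σ+1)/2` (written `2·# = σ(σ+1)`). [folklore] -/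
private theorem two_mul_card_natTri (σ : ℕ) : 2 * (natTri σ).card = σ * (σ + 1) := by
  induction σ with
  | zero => rfl
  | succ σ ih =>
    have hsplit : natTri (σ + 1) = natTri σ ∪ antidiagonal σ := by
      ext p
      simp only [mem_union, mem_natTri, HasAntidiagonal.mem_antidiagonal]
      omega
    have hdisj : Disjoint (natTri σ) (antidiagonal σ) := by
      rw [disjoint_left]
      intro p hp hq
      rw [mem_natTri] at hp
      rw [HasAntidiagonal.mem_antidiagonal] at hq
      omega
    rw [hsplit, card_union_of_disjoint hdisj, Nat.card_antidiagonal]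
    nlinarith [ih]

/-- The lower-left corner triangle of the box is a copy of `natTri σ`. [folklore] -/
private theorem card_lowerTri {X Y σ : ℕ} (hσX : σ ≤ X + 1) (hσY : σ ≤ Y + 1) :
    2 * (((Icc (0 : ℤ) X) ×ˢ (Icc (0 : ℤ) Y)).filter fun p => p.1 + p.2 < (σ : ℤ)).card = σ * (σ + 1) := by
  have h : (((Icc (0 : ℤ) X) ×ˢ (Icc (0 : ℤ) Y)).filter fun p => p.1 + p.2 < (σ : ℤ)) =
      (natTri σ).image fun p : ℕ × ℕ => ((p.1 : ℤ), (p.2 : ℤ)) := by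
    ext p
    simp only [mem_filter, mem_product, mem_Icc, mem_image, mem_natTri, Prod.ext_iff]
    constructor
    · rintro ⟨⟨⟨h1, h2⟩, h3, h4⟩, h5⟩
      exact ⟨(p.1.toNat, p.2.toNat), by omega, by simp only; omega, by simp only; omega⟩
    · rintro ⟨q, hq, h1, h2⟩
      omega
  rw [h, card_image_of_injective _ (fun a b hab => by
    simp only [Prod.ext_iff, Nat.cast_inj] at hab; exact Prod.ext hab.1 hab.2)]
  exact two_mul_card_natTri σ

/-- The upper-right corner triangle of the box is a copy of `natTri t`, `t = X + Y − τ`. [folklore] -/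
private theorem card_upperTri {X Y τ t : ℕ} (ht : X + Y = τ + t) (htX : t ≤ X + 1) (htY : t ≤ Y + 1) :
    2 * (((Icc (0 : ℤ) X) ×ˢ (Icc (0 : ℤ) Y)).filter fun p => (τ : ℤ) < p.1 + p.2).card = t * (t + 1) := by
  have h : (((Icc (0 : ℤ) X) ×ˢ (Icc (0 : ℤ) Y)).filter fun p => (τ : ℤ) < p.1 + p.2) =
      (natTri t).image fun p : ℕ × ℕ => ((X : ℤ) - p.1, (Y : ℤ) - p.2) := by
    ext p
    simp only [mem_filter, mem_product, mem_Icc, mem_image, mem_natTri, Prod.ext_iff]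
    constructor
    · rintro ⟨⟨⟨h1, h2⟩, h3, h4⟩, h5⟩
      exact ⟨(((X : ℤ) - p.1).toNat, ((Y : ℤ) - p.2).toNat), by omega, by simp only; omega,
        by simp only; omega⟩
    · rintro ⟨q, hq, h1, h2⟩
      omega
  rw [h, card_image_of_injective _ (fun a b hab => by
    simp only [Prod.ext_iff] at hab; refine Prod.ext ?_ ?_ <;> omega)]
  exact two_mul_card_natTri t

/-- **`2 · #G(X,Y,σ,τ;0,0) = 2(X+1)(Y+1) − σ(σ+1) − t(t+1)`**, `t = X + Y − τ` (the box minus the two corner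
triangles). [cite: LucaFriesecke2017, §2 p0005] -/
theorem two_mul_card_hexShape_zero {X Y σ τ t : ℕ} (ht : X + Y = τ + t) (hσX : σ ≤ X + 1) (hσY : σ ≤ Y + 1)
    (htX : t ≤ X + 1) (htY : t ≤ Y + 1) (hστ : σ ≤ τ) :
    2 * (hexShape X Y σ τ 0 0).card + σ * (σ + 1) + t * (t + 1) = 2 * (X + 1) * (Y + 1) := by
  set box : Finset (ℤ × ℤ) := (Icc (0 : ℤ) X) ×ˢ (Icc (0 : ℤ) Y) with hbox
  have hcardbox : box.card = (X + 1) * (Y + 1) := by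
    rw [hbox, card_product, Int.card_Icc, Int.card_Icc]
    have h1 : ((X : ℤ) + 1 - 0).toNat = X + 1 := by omega
    have h2 : ((Y : ℤ) + 1 - 0).toNat = Y + 1 := by omega
    rw [h1, h2]
  have hG : hexShape X Y σ τ 0 0 = box.filter fun p => (σ : ℤ) ≤ p.1 + p.2 ∧ p.1 + p.2 ≤ (τ : ℤ) := by
    ext p
    rw [mem_hexShape, mem_filter, hbox, mem_product, mem_Icc, mem_Icc]
    omega
  have hsplit := card_filter_add_card_filter_not
    (s := box) (fun p : ℤ × ℤ => (σ : ℤ) ≤ p.1 + p.2 ∧ p.1 + p.2 ≤ (τ : ℤ))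
  have hneg : (box.filter fun p => ¬((σ : ℤ) ≤ p.1 + p.2 ∧ p.1 + p.2 ≤ (τ : ℤ))) =
      (box.filter fun p => p.1 + p.2 < (σ : ℤ)) ∪ (box.filter fun p => (τ : ℤ) < p.1 + p.2) := by
    ext p
    simp only [mem_filter, mem_union]
    constructor
    · rintro ⟨hb, hn⟩
      by_cases h1 : p.1 + p.2 < (σ : ℤ)
      · exact Or.inl ⟨hb, h1⟩
      · exact Or.inr ⟨hb, by omega⟩
    · rintro (⟨hb, h1⟩ | ⟨hb, h1⟩) <;> exact ⟨hb, by omega⟩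
  have hdisj : Disjoint (box.filter fun p => p.1 + p.2 < (σ : ℤ))
      (box.filter fun p => (τ : ℤ) < p.1 + p.2) := by
    rw [disjoint_left]
    intro p h1 h2
    rw [mem_filter] at h1 h2
    omega
  rw [hneg, card_union_of_disjoint hdisj, hcardbox] at hsplit
  rw [hG]
  have h1 := card_lowerTri (X := X) (Y := Y) hσX hσY
  have h2 := card_upperTri ht htX htY
  rw [← hbox] at h1 h2
  linarith

/-- The clipped labels: `G(…;0,0) ∖ G(…;u,v)` consists of the `u` tail labels and the `v` vertex labels.
[cite: LucaFriesecke2017, §2 p0005] -/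
theorem card_hexShape {X Y σ τ u v : ℕ} (h : HexParams X Y σ τ u v) :
    (hexShape X Y σ τ u v).card + u + v = (hexShape X Y σ τ 0 0).card := by
  obtain ⟨hσX, hσY, hXτ, hYτ, hτ, huX, huτ, hX, hY, hv⟩ := h
  have hsub : hexShape X Y σ τ u v ⊆ hexShape X Y σ τ 0 0 := by
    intro p hp
    rw [mem_hexShape] at hp ⊢
    omega
  -- the removed labels
  set T : Finset (ℤ × ℤ) := (range u).image fun i : ℕ => ((i : ℤ), (Y : ℤ)) with hT
  set V : Finset (ℤ × ℤ) := (range v).image fun _ : ℕ => ((X : ℤ), (0 : ℤ)) with hV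
  have mem_T : ∀ p : ℤ × ℤ, p ∈ T ↔ 0 ≤ p.1 ∧ p.1 < u ∧ p.2 = Y := by
    intro p
    simp only [hT, mem_image, mem_range, Prod.ext_iff]
    constructor
    · rintro ⟨i, hi, h1, h2⟩
      omega
    · rintro ⟨h1, h2, h3⟩
      exact ⟨p.1.toNat, by omega, by omega, by omega⟩
  have mem_V : ∀ p : ℤ × ℤ, p ∈ V ↔ 1 ≤ v ∧ p.1 = X ∧ p.2 = 0 := by
    intro p
    simp only [hV, mem_image, mem_range, Prod.ext_iff]
    constructor
    · rintro ⟨i, hi, h1, h2⟩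
      omega
    · rintro ⟨h1, h2, h3⟩
      exact ⟨0, by omega, by omega, by omega⟩
  have hTcard : T.card = u := by
    rw [hT, card_image_of_injective _ (fun a b hab => by simpa using hab), card_range]
  have hVcard : V.card = v := by
    interval_cases v
    · simp [hV]
    · simp [hV]
  have hdiff : hexShape X Y σ τ 0 0 \ hexShape X Y σ τ u v = T ∪ V := by
    ext p
    rw [mem_sdiff, mem_hexShape, mem_hexShape, mem_union, mem_T, mem_V]
    omega
  have hdisjTV : Disjoint T V := by
    rw [disjoint_left]
    intro p h1 h2
    rw [mem_T] at h1
    rw [mem_V] at h2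
    omega
  have := card_sdiff_add_card_eq_card hsub
  rw [hdiff, card_union_of_disjoint hdisjTV, hTcard, hVcard] at this
  omega


/-! ## §3 Harborth's bound for the clipped hexagons -/

/-- A 3-convex label set with `⌈√(12n−3)⌉` lattice lines attains Harborth's bound `2[3n − √(12n−3)]`.
[cite: DavoliPiovanoStefanelli2017, (10)–(12) p. 630] -/
theorem adjCount_eq_of_lineCount {S : Finset (ℤ × ℤ)} (hconv : IsTriConvex S)
    (hL : (lineCount S : ℤ) = ⌈Real.sqrt (12 * S.card - 3)⌉) :
    (adjCount S : ℤ) = 2 * harborthNumber S.card :=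
  le_antisymm (adjCount_le_two_mul_harborthNumber S)
    ((isTriMinimizer_image_triPoint_iff S).1 (isTriMinimizer_of_lineCount_eq hconv hL))

/-! ## §4 Five-valent labels: none in a hexagon, one below a clipped row end, one inside a clipped vertex -/

section Degrees

variable {X Y σ τ u v : ℕ} {q : ℤ × ℤ}

/-- The indicator is at most one. [folklore] -/
private theorem ind_le_one (S : Finset (ℤ × ℤ)) (p : ℤ × ℤ) : ind S p ≤ 1 := by
  unfold ind; split_ifs <;> omega

/-- The indicator vanishes exactly off the set. [folklore] -/
private theorem ind_eq_zero_iff (S : Finset (ℤ × ℤ)) (p : ℤ × ℤ) : ind S p = 0 ↔ p ∉ S := by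
  unfold ind; split_ifs with h <;> simp [h]

/-- The indicator is one exactly on the set. [folklore] -/
private theorem ind_eq_one_iff (S : Finset (ℤ × ℤ)) (p : ℤ × ℤ) : ind S p = 1 ↔ p ∈ S := by
  unfold ind; split_ifs with h <;> simp [h]

/-- A missing right neighbour forces a second missing neighbour. [folklore] -/
private theorem absent_right (hq : q ∈ hexShape X Y σ τ u v)
    (ha : (q.1 + 1, q.2) ∉ hexShape X Y σ τ u v) :
    (q.1 + 1, q.2 - 1) ∉ hexShape X Y σ τ u v ∨ (q.1, q.2 + 1) ∉ hexShape X Y σ τ u v := by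
  rw [mem_hexShape] at hq ha ⊢; rw [mem_hexShape]; dsimp only at hq ha ⊢; omega

/-- A missing left neighbour forces a second missing neighbour. [folklore] -/
private theorem absent_left (hq : q ∈ hexShape X Y σ τ u v)
    (ha : (q.1 - 1, q.2) ∉ hexShape X Y σ τ u v) :
    (q.1 - 1, q.2 + 1) ∉ hexShape X Y σ τ u v ∨ (q.1, q.2 - 1) ∉ hexShape X Y σ τ u v ∨
      (q.1, q.2 + 1) ∉ hexShape X Y σ τ u v := by
  rw [mem_hexShape] at hq ha ⊢; rw [mem_hexShape, mem_hexShape]; dsimp only at hq ha ⊢; omega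

/-- A missing upper neighbour forces a second missing neighbour. [folklore] -/
private theorem absent_up (hq : q ∈ hexShape X Y σ τ u v)
    (ha : (q.1, q.2 + 1) ∉ hexShape X Y σ τ u v) :
    (q.1 - 1, q.2 + 1) ∉ hexShape X Y σ τ u v ∨ (q.1 + 1, q.2) ∉ hexShape X Y σ τ u v := by
  rw [mem_hexShape] at hq ha ⊢; rw [mem_hexShape]; dsimp only at hq ha ⊢; omega

/-- A missing lower neighbour forces a second missing neighbour. [folklore] -/
private theorem absent_down (hq : q ∈ hexShape X Y σ τ u v)
    (ha : (q.1, q.2 - 1) ∉ hexShape X Y σ τ u v) :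
    (q.1 + 1, q.2 - 1) ∉ hexShape X Y σ τ u v ∨ (q.1 - 1, q.2) ∉ hexShape X Y σ τ u v := by
  rw [mem_hexShape] at hq ha ⊢; rw [mem_hexShape]; dsimp only at hq ha ⊢; omega

/-- A missing lower-right neighbour forces a second missing neighbour, unless `q` is the inner neighbour
`(X−1, 1)` of the clipped vertex. [folklore] -/
private theorem absent_downright (hq : q ∈ hexShape X Y σ τ u v)
    (ha : (q.1 + 1, q.2 - 1) ∉ hexShape X Y σ τ u v) :
    (q.1 + 1, q.2) ∉ hexShape X Y σ τ u v ∨ (q.1, q.2 - 1) ∉ hexShape X Y σ τ u v ∨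
      (1 ≤ v ∧ q.1 = (X : ℤ) - 1 ∧ q.2 = 1) := by
  rw [mem_hexShape] at hq ha ⊢; rw [mem_hexShape]; dsimp only at hq ha ⊢; omega

/-- A missing upper-left neighbour forces a second missing neighbour, unless `q` is the label `(u, Y−1)`
below the end of the clipped row. [folklore] -/
private theorem absent_upleft (hq : q ∈ hexShape X Y σ τ u v)
    (ha : (q.1 - 1, q.2 + 1) ∉ hexShape X Y σ τ u v) :
    (q.1 - 1, q.2) ∉ hexShape X Y σ τ u v ∨ (q.1, q.2 + 1) ∉ hexShape X Y σ τ u v ∨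
      (1 ≤ u ∧ q.1 = (u : ℤ) ∧ q.2 = (Y : ℤ) - 1) := by
  rw [mem_hexShape] at hq ha ⊢; rw [mem_hexShape]; dsimp only at hq ha ⊢; omega

/-- **A `5`-valent label of `G(X,Y,σ,τ;u,v)` is `(u, Y−1)` (with `u ≥ 1`) or `(X−1, 1)` (with `v = 1`)**:
in a lattice hexagon a missing neighbour `q + e` violates one of the half-plane constraints or is clipped,
and then a second neighbour is missing too — except at the two designated labels.
[cite: LucaFriesecke2017, §2 p0005] -/
theorem of_card_filter_adj_eq_five (hq : q ∈ hexShape X Y σ τ u v)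
    (h5 : ((hexShape X Y σ τ u v).filter (Adj q)).card = 5) :
    (1 ≤ u ∧ q.1 = (u : ℤ) ∧ q.2 = (Y : ℤ) - 1) ∨ (1 ≤ v ∧ q.1 = (X : ℤ) - 1 ∧ q.2 = 1) := by
  set S := hexShape X Y σ τ u v with hS
  rw [card_filter_adj] at h5
  have i1 := ind_le_one S (q.1 + 1, q.2)
  have i2 := ind_le_one S (q.1 - 1, q.2)
  have i3 := ind_le_one S (q.1, q.2 + 1)
  have i4 := ind_le_one S (q.1, q.2 - 1)
  have i5 := ind_le_one S (q.1 + 1, q.2 - 1)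
  have i6 := ind_le_one S (q.1 - 1, q.2 + 1)
  have e1 := ind_eq_zero_iff S (q.1 + 1, q.2)
  have e2 := ind_eq_zero_iff S (q.1 - 1, q.2)
  have e3 := ind_eq_zero_iff S (q.1, q.2 + 1)
  have e4 := ind_eq_zero_iff S (q.1, q.2 - 1)
  have e5 := ind_eq_zero_iff S (q.1 + 1, q.2 - 1)
  have e6 := ind_eq_zero_iff S (q.1 - 1, q.2 + 1)
  have a1 : ind S (q.1 + 1, q.2) = 0 → ind S (q.1 + 1, q.2 - 1) = 0 ∨ ind S (q.1, q.2 + 1) = 0 := by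
    rw [e1, e5, e3]; exact absent_right hq
  have a2 : ind S (q.1 - 1, q.2) = 0 →
      ind S (q.1 - 1, q.2 + 1) = 0 ∨ ind S (q.1, q.2 - 1) = 0 ∨ ind S (q.1, q.2 + 1) = 0 := by
    rw [e2, e6, e4, e3]; exact absent_left hq
  have a3 : ind S (q.1, q.2 + 1) = 0 → ind S (q.1 - 1, q.2 + 1) = 0 ∨ ind S (q.1 + 1, q.2) = 0 := by
    rw [e3, e6, e1]; exact absent_up hq
  have a4 : ind S (q.1, q.2 - 1) = 0 → ind S (q.1 + 1, q.2 - 1) = 0 ∨ ind S (q.1 - 1, q.2) = 0 := by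
    rw [e4, e5, e2]; exact absent_down hq
  have a5 : ind S (q.1 + 1, q.2 - 1) = 0 → ind S (q.1 + 1, q.2) = 0 ∨ ind S (q.1, q.2 - 1) = 0 ∨
      (1 ≤ v ∧ q.1 = (X : ℤ) - 1 ∧ q.2 = 1) := by
    rw [e5, e1, e4]; exact absent_downright hq
  have a6 : ind S (q.1 - 1, q.2 + 1) = 0 → ind S (q.1 - 1, q.2) = 0 ∨ ind S (q.1, q.2 + 1) = 0 ∨
      (1 ≤ u ∧ q.1 = (u : ℤ) ∧ q.2 = (Y : ℤ) - 1) := by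
    rw [e6, e2, e3]; exact absent_upleft hq
  omega

/-- The label `(u, Y−1)` below the end of the clipped row has exactly `5` neighbours. [cite: LucaFriesecke2017, §2 p0005] -/
theorem card_filter_adj_tailPoint (h : HexParams X Y σ τ u v) (hY3 : 3 ≤ Y) (hu : 1 ≤ u) :
    ((hexShape X Y σ τ u v).filter (Adj ((u : ℤ), (Y : ℤ) - 1))).card = 5 := by
  obtain ⟨hσX, hσY, hXτ, hYτ, hτ, huX, huτ, hX, hY, hv⟩ := h
  rw [card_filter_adj]
  dsimp only
  have m1 : ((u : ℤ) + 1, (Y : ℤ) - 1) ∈ hexShape X Y σ τ u v := by rw [mem_hexShape]; dsimp only; omega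
  have m2 : ((u : ℤ) - 1, (Y : ℤ) - 1) ∈ hexShape X Y σ τ u v := by rw [mem_hexShape]; dsimp only; omega
  have m3 : ((u : ℤ), (Y : ℤ) - 1 + 1) ∈ hexShape X Y σ τ u v := by rw [mem_hexShape]; dsimp only; omega
  have m4 : ((u : ℤ), (Y : ℤ) - 1 - 1) ∈ hexShape X Y σ τ u v := by rw [mem_hexShape]; dsimp only; omega
  have m5 : ((u : ℤ) + 1, (Y : ℤ) - 1 - 1) ∈ hexShape X Y σ τ u v := by
    rw [mem_hexShape]; dsimp only; omega
  have m6 : ((u : ℤ) - 1, (Y : ℤ) - 1 + 1) ∉ hexShape X Y σ τ u v := by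
    rw [mem_hexShape]; dsimp only; omega
  rw [(ind_eq_one_iff _ _).2 m1, (ind_eq_one_iff _ _).2 m2, (ind_eq_one_iff _ _).2 m3,
    (ind_eq_one_iff _ _).2 m4, (ind_eq_one_iff _ _).2 m5, (ind_eq_zero_iff _ _).2 m6]

/-- The inner neighbour `(X−1, 1)` of the clipped vertex has exactly `5` neighbours. [cite: LucaFriesecke2017, §2 p0005] -/
theorem card_filter_adj_vertexPoint (h : HexParams X Y σ τ u 1) (hY3 : 3 ≤ Y) :
    ((hexShape X Y σ τ u 1).filter (Adj ((X : ℤ) - 1, 1))).card = 5 := by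
  obtain ⟨hσX, hσY, hXτ, hYτ, hτ, huX, huτ, hX, hY, hv⟩ := h
  rw [card_filter_adj]
  dsimp only
  have m1 : ((X : ℤ) - 1 + 1, (1 : ℤ)) ∈ hexShape X Y σ τ u 1 := by rw [mem_hexShape]; dsimp only; omega
  have m2 : ((X : ℤ) - 1 - 1, (1 : ℤ)) ∈ hexShape X Y σ τ u 1 := by rw [mem_hexShape]; dsimp only; omega
  have m3 : ((X : ℤ) - 1, (1 : ℤ) + 1) ∈ hexShape X Y σ τ u 1 := by rw [mem_hexShape]; dsimp only; omega
  have m4 : ((X : ℤ) - 1, (1 : ℤ) - 1) ∈ hexShape X Y σ τ u 1 := by rw [mem_hexShape]; dsimp only; omega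
  have m5 : ((X : ℤ) - 1 + 1, (1 : ℤ) - 1) ∉ hexShape X Y σ τ u 1 := by
    rw [mem_hexShape]; dsimp only; omega
  have m6 : ((X : ℤ) - 1 - 1, (1 : ℤ) + 1) ∈ hexShape X Y σ τ u 1 := by
    rw [mem_hexShape]; dsimp only; omega
  rw [(ind_eq_one_iff _ _).2 m1, (ind_eq_one_iff _ _).2 m2, (ind_eq_one_iff _ _).2 m3,
    (ind_eq_one_iff _ _).2 m4, (ind_eq_zero_iff _ _).2 m5, (ind_eq_one_iff _ _).2 m6]

/-- In a full lattice hexagon no label is `5`-valent. [cite: LucaFriesecke2017, §2 p0005] -/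
theorem card_degree_five_hexShape_zero (X Y σ τ : ℕ) :
    ((hexShape X Y σ τ 0 0).filter fun p => ((hexShape X Y σ τ 0 0).filter (Adj p)).card = 5).card = 0 := by
  rw [card_eq_zero, filter_eq_empty_iff]
  intro q hq h5
  have := of_card_filter_adj_eq_five hq h5
  omega

/-- With a clipped row end (`u ≥ 1`, `v = 0`) exactly one label is `5`-valent. [cite: LucaFriesecke2017, §2 p0005] -/
theorem card_degree_five_hexShape_tail (h : HexParams X Y σ τ u 0) (hY3 : 3 ≤ Y) (hu : 1 ≤ u) :
    ((hexShape X Y σ τ u 0).filter fun p => ((hexShape X Y σ τ u 0).filter (Adj p)).card = 5).card = 1 := by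
  rw [card_eq_one]
  refine ⟨((u : ℤ), (Y : ℤ) - 1), ?_⟩
  ext q
  rw [mem_filter, mem_singleton]
  constructor
  · rintro ⟨hq, h5⟩
    have := of_card_filter_adj_eq_five hq h5
    ext <;> dsimp only <;> omega
  · rintro rfl
    have hmem : ((u : ℤ), (Y : ℤ) - 1) ∈ hexShape X Y σ τ u 0 := by
      obtain ⟨hσX, hσY, hXτ, hYτ, hτ, huX, huτ, hX, hY, hv⟩ := h
      rw [mem_hexShape]; dsimp only; omega
    exact ⟨hmem, card_filter_adj_tailPoint h hY3 hu⟩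

/-- With a clipped row end and a clipped vertex (`u ≥ 1`, `v = 1`) exactly two labels are `5`-valent.
[cite: LucaFriesecke2017, §2 p0005] -/
theorem card_degree_five_hexShape_tail_vertex (h : HexParams X Y σ τ u 1) (hY3 : 3 ≤ Y) (hu : 1 ≤ u) :
    ((hexShape X Y σ τ u 1).filter fun p => ((hexShape X Y σ τ u 1).filter (Adj p)).card = 5).card = 2 := by
  have hp := h
  obtain ⟨hσX, hσY, hXτ, hYτ, hτ, huX, huτ, hX, hY, hv⟩ := h
  rw [card_eq_two]
  refine ⟨((u : ℤ), (Y : ℤ) - 1), ((X : ℤ) - 1, 1), ?_, ?_⟩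
  · simp only [ne_eq, Prod.ext_iff, not_and]
    intro _
    omega
  ext q
  rw [mem_filter, mem_insert, mem_singleton]
  constructor
  · rintro ⟨hq, h5⟩
    rcases of_card_filter_adj_eq_five hq h5 with h1 | h1
    · left; ext <;> dsimp only <;> omega
    · right; ext <;> dsimp only <;> omega
  · rintro (rfl | rfl)
    · have hmem : ((u : ℤ), (Y : ℤ) - 1) ∈ hexShape X Y σ τ u 1 := by
        rw [mem_hexShape]; dsimp only; omega
      exact ⟨hmem, card_filter_adj_tailPoint hp hY3 hu⟩
    · have hmem : ((X : ℤ) - 1, (1 : ℤ)) ∈ hexShape X Y σ τ u 1 := by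
        rw [mem_hexShape]; dsimp only; omega
      exact ⟨hmem, card_filter_adj_vertexPoint hp hY3⟩

end Degrees

/-! ## §5 The non-uniqueness criterion for two clipped hexagons -/

/-- **Two clipped hexagons with the same number of labels, both attaining Harborth's bound, with different
numbers of `5`-valent labels, are two ground states not related by a rigid motion.**
[cite: LucaFriesecke2017, §2 p0005] -/
theorem not_isUniqueUpToRigidMotion_of_hexShapes {N : ℕ} {X Y σ τ u v X' Y' σ' τ' u' v' : ℕ}
    (hN : (hexShape X Y σ τ u v).card = N) (hN' : (hexShape X' Y' σ' τ' u' v').card = N)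
    (hL : ((lineCount (hexShape X Y σ τ u v) : ℕ) : ℤ) = ⌈Real.sqrt (12 * (N : ℝ) - 3)⌉)
    (hL' : ((lineCount (hexShape X' Y' σ' τ' u' v') : ℕ) : ℤ) = ⌈Real.sqrt (12 * (N : ℝ) - 3)⌉)
    (hne : ((hexShape X Y σ τ u v).filter fun p =>
        ((hexShape X Y σ τ u v).filter (Adj p)).card = 5).card ≠
      ((hexShape X' Y' σ' τ' u' v').filter fun p =>
        ((hexShape X' Y' σ' τ' u' v').filter (Adj p)).card = 5).card) :
    ¬ IsUniqueUpToRigidMotion N := by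
  have h1 := adjCount_eq_of_lineCount (isTriConvex_hexShape X Y σ τ u v) (by rw [hN]; exact hL)
  have h2 := adjCount_eq_of_lineCount (isTriConvex_hexShape X' Y' σ' τ' u' v') (by rw [hN']; exact hL')
  rw [hN] at h1
  rw [hN'] at h2
  exact not_isUniqueUpToRigidMotion_of_card_filter_ne hN hN' h1 h2 5 hne


/-! ## §6 Instances: the remaining non-uniqueness families of De Luca–Friesecke's Theorem 1.1 -/

/-- Cardinality and line count of a clipped hexagon from its parameters. [cite: LucaFriesecke2017, §2 p0005] -/
theorem card_and_lineCount_hexShape {X Y σ τ u v t N ℓ : ℕ} (h : HexParams X Y σ τ u v)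
    (ht : X + Y = τ + t) (htX : t ≤ X + 1) (htY : t ≤ Y + 1)
    (hcard : 2 * (N + u + v) + σ * (σ + 1) + t * (t + 1) = 2 * (X + 1) * (Y + 1))
    (hℓ : (X + 1) + (Y + 1) + (τ - σ + 1) = ℓ) :
    (hexShape X Y σ τ u v).card = N ∧ lineCount (hexShape X Y σ τ u v) = ℓ := by
  have h0 := two_mul_card_hexShape_zero (σ := σ) ht (by have := h.hσX; omega) (by have := h.hσY; omega) htX htY
    (by have := h.hσX; have := h.hXτ; omega)
  have h1 := card_hexShape h
  refine ⟨by linarith, by rw [lineCount_hexShape h, hℓ]⟩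

/-- `⌈√(12N − 3)⌉ = ℓ` from `(ℓ−1)² < 12N − 3 ≤ ℓ²`. [cite: DavoliPiovanoStefanelli2017, (12) p. 630] -/
theorem ceil_sqrt_eq_of {N ℓ : ℕ} (hℓ : 1 ≤ ℓ) (hlo : ℓ ^ 2 + 4 < 12 * N + 2 * ℓ) (hhi : 12 * N ≤ ℓ ^ 2 + 3) :
    ⌈Real.sqrt (12 * (N : ℝ) - 3)⌉ = ℓ := by
  have hℓr : (1 : ℝ) ≤ ℓ := by exact_mod_cast hℓ
  have hlor : (ℓ : ℝ) ^ 2 + 4 < 12 * N + 2 * ℓ := by exact_mod_cast hlo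
  have hhir : 12 * (N : ℝ) ≤ (ℓ : ℝ) ^ 2 + 3 := by exact_mod_cast hhi
  rw [Int.ceil_eq_iff]
  push_cast
  constructor
  · rw [Real.lt_sqrt (by linarith)]
    nlinarith
  · rw [Real.sqrt_le_left (by positivity)]
    linarith

/-- **Non-uniqueness from a pair of clipped hexagons**, packaged. [cite: LucaFriesecke2017, §2 p0005] -/
theorem not_isUniqueUpToRigidMotion_of_pair {N ℓ : ℕ} {X Y σ τ u v X' Y' σ' τ' u' v' : ℕ}
    (hc : (hexShape X Y σ τ u v).card = N ∧ lineCount (hexShape X Y σ τ u v) = ℓ)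
    (hc' : (hexShape X' Y' σ' τ' u' v').card = N ∧ lineCount (hexShape X' Y' σ' τ' u' v') = ℓ)
    (hceil : ⌈Real.sqrt (12 * (N : ℝ) - 3)⌉ = ℓ)
    (hne : ((hexShape X Y σ τ u v).filter fun p =>
        ((hexShape X Y σ τ u v).filter (Adj p)).card = 5).card ≠
      ((hexShape X' Y' σ' τ' u' v').filter fun p =>
        ((hexShape X' Y' σ' τ' u' v').filter (Adj p)).card = 5).card) :
    ¬ IsUniqueUpToRigidMotion N :=
  not_isUniqueUpToRigidMotion_of_hexShapes hc.1 hc'.1 (by rw [hc.2, hceil]) (by rw [hc'.2, hceil]) hne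

/-- **Family R1** (`j = s − 1`, `k ∈ {0,…,4}`, `s = r + 1 ≥ 3`): `N = a_n − 1`, one label short of De
Luca–Friesecke's number `a_n = 3s²+3s+1+(s+1)k+s`.  The balanced hexagon of `a_n` labels minus a vertex
(one `5`-valent label) against the full unbalanced hexagon with `a_n − 1` labels (no `5`-valent label).
[cite: LucaFriesecke2017, Theorem 1.1 and §2 p0003–p0005] -/
theorem not_isUniqueUpToRigidMotion_pred (r k : ℕ) (hr : 2 ≤ r) (hk : k ≤ 4) :
    ¬ IsUniqueUpToRigidMotion (3 * (r + 1) ^ 2 + 3 * (r + 1) + 1 + (r + 1 + 1) * k + r) := by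
  interval_cases k
  · -- k = 0: N = 3r² + 10r + 7, ℓ = 6r + 10
    have hA : HexParams (2 * r + 1) (2 * r + 3) r (3 * r + 3) 0 0 :=
      ⟨by omega, by omega, by omega, by omega, by omega, by omega, by omega, by omega, by omega, by omega⟩
    have hB : HexParams (2 * r + 2) (2 * r + 3) (r + 1) (3 * r + 3) 1 0 :=
      ⟨by omega, by omega, by omega, by omega, by omega, by omega, by omega, by omega, by omega, by omega⟩
    have cA := card_and_lineCount_hexShape (N := 3 * r ^ 2 + 10 * r + 7) (ℓ := 6 * r + 10) (t := r + 1)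
      hA (by omega) (by omega) (by omega) (by ring) (by omega)
    have cB := card_and_lineCount_hexShape (N := 3 * r ^ 2 + 10 * r + 7) (ℓ := 6 * r + 10) (t := r + 2)
      hB (by omega) (by omega) (by omega) (by ring) (by omega)
    rw [show 3 * (r + 1) ^ 2 + 3 * (r + 1) + 1 + (r + 1 + 1) * 0 + r = 3 * r ^ 2 + 10 * r + 7 by ring]
    refine not_isUniqueUpToRigidMotion_of_pair cA cB (ceil_sqrt_eq_of (by omega) (by nlinarith) (by nlinarith)) ?_
    rw [card_degree_five_hexShape_zero, card_degree_five_hexShape_tail hB (by omega) le_rfl]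
    omega
  · -- k = 1: N = 3r² + 11r + 9, ℓ = 6r + 11
    have hA : HexParams (2 * r + 2) (2 * r + 4) (r + 2) (3 * r + 4) 0 0 :=
      ⟨by omega, by omega, by omega, by omega, by omega, by omega, by omega, by omega, by omega, by omega⟩
    have hB : HexParams (2 * r + 2) (2 * r + 3) (r + 1) (3 * r + 4) 1 0 :=
      ⟨by omega, by omega, by omega, by omega, by omega, by omega, by omega, by omega, by omega, by omega⟩
    have cA := card_and_lineCount_hexShape (N := 3 * r ^ 2 + 11 * r + 9) (ℓ := 6 * r + 11) (t := r + 2)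
      hA (by omega) (by omega) (by omega) (by ring) (by omega)
    have cB := card_and_lineCount_hexShape (N := 3 * r ^ 2 + 11 * r + 9) (ℓ := 6 * r + 11) (t := r + 1)
      hB (by omega) (by omega) (by omega) (by ring) (by omega)
    rw [show 3 * (r + 1) ^ 2 + 3 * (r + 1) + 1 + (r + 1 + 1) * 1 + r = 3 * r ^ 2 + 11 * r + 9 by ring]
    refine not_isUniqueUpToRigidMotion_of_pair cA cB (ceil_sqrt_eq_of (by omega) (by nlinarith) (by nlinarith)) ?_
    rw [card_degree_five_hexShape_zero, card_degree_five_hexShape_tail hB (by omega) le_rfl]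
    omega
  · -- k = 2: N = 3r² + 12r + 11, ℓ = 6r + 12
    have hA : HexParams (2 * r + 2) (2 * r + 4) (r + 1) (3 * r + 4) 0 0 :=
      ⟨by omega, by omega, by omega, by omega, by omega, by omega, by omega, by omega, by omega, by omega⟩
    have hB : HexParams (2 * r + 3) (2 * r + 3) (r + 1) (3 * r + 4) 1 0 :=
      ⟨by omega, by omega, by omega, by omega, by omega, by omega, by omega, by omega, by omega, by omega⟩
    have cA := card_and_lineCount_hexShape (N := 3 * r ^ 2 + 12 * r + 11) (ℓ := 6 * r + 12) (t := r + 2)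
      hA (by omega) (by omega) (by omega) (by ring) (by omega)
    have cB := card_and_lineCount_hexShape (N := 3 * r ^ 2 + 12 * r + 11) (ℓ := 6 * r + 12) (t := r + 2)
      hB (by omega) (by omega) (by omega) (by ring) (by omega)
    rw [show 3 * (r + 1) ^ 2 + 3 * (r + 1) + 1 + (r + 1 + 1) * 2 + r = 3 * r ^ 2 + 12 * r + 11 by ring]
    refine not_isUniqueUpToRigidMotion_of_pair cA cB (ceil_sqrt_eq_of (by omega) (by nlinarith) (by nlinarith)) ?_
    rw [card_degree_five_hexShape_zero, card_degree_five_hexShape_tail hB (by omega) le_rfl]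
    omega
  · -- k = 3: N = 3r² + 13r + 13, ℓ = 6r + 13
    have hA : HexParams (2 * r + 2) (2 * r + 4) (r + 1) (3 * r + 5) 0 0 :=
      ⟨by omega, by omega, by omega, by omega, by omega, by omega, by omega, by omega, by omega, by omega⟩
    have hB : HexParams (2 * r + 3) (2 * r + 4) (r + 2) (3 * r + 5) 1 0 :=
      ⟨by omega, by omega, by omega, by omega, by omega, by omega, by omega, by omega, by omega, by omega⟩
    have cA := card_and_lineCount_hexShape (N := 3 * r ^ 2 + 13 * r + 13) (ℓ := 6 * r + 13) (t := r + 1)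
      hA (by omega) (by omega) (by omega) (by ring) (by omega)
    have cB := card_and_lineCount_hexShape (N := 3 * r ^ 2 + 13 * r + 13) (ℓ := 6 * r + 13) (t := r + 2)
      hB (by omega) (by omega) (by omega) (by ring) (by omega)
    rw [show 3 * (r + 1) ^ 2 + 3 * (r + 1) + 1 + (r + 1 + 1) * 3 + r = 3 * r ^ 2 + 13 * r + 13 by ring]
    refine not_isUniqueUpToRigidMotion_of_pair cA cB (ceil_sqrt_eq_of (by omega) (by nlinarith) (by nlinarith)) ?_
    rw [card_degree_five_hexShape_zero, card_degree_five_hexShape_tail hB (by omega) le_rfl]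
    omega
  · -- k = 4: N = 3r² + 14r + 15, ℓ = 6r + 14
    have hA : HexParams (2 * r + 3) (2 * r + 5) (r + 2) (3 * r + 5) 0 0 :=
      ⟨by omega, by omega, by omega, by omega, by omega, by omega, by omega, by omega, by omega, by omega⟩
    have hB : HexParams (2 * r + 3) (2 * r + 4) (r + 1) (3 * r + 5) 1 0 :=
      ⟨by omega, by omega, by omega, by omega, by omega, by omega, by omega, by omega, by omega, by omega⟩
    have cA := card_and_lineCount_hexShape (N := 3 * r ^ 2 + 14 * r + 15) (ℓ := 6 * r + 14) (t := r + 3)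
      hA (by omega) (by omega) (by omega) (by ring) (by omega)
    have cB := card_and_lineCount_hexShape (N := 3 * r ^ 2 + 14 * r + 15) (ℓ := 6 * r + 14) (t := r + 2)
      hB (by omega) (by omega) (by omega) (by ring) (by omega)
    rw [show 3 * (r + 1) ^ 2 + 3 * (r + 1) + 1 + (r + 1 + 1) * 4 + r = 3 * r ^ 2 + 14 * r + 15 by ring]
    refine not_isUniqueUpToRigidMotion_of_pair cA cB (ceil_sqrt_eq_of (by omega) (by nlinarith) (by nlinarith)) ?_
    rw [card_degree_five_hexShape_zero, card_degree_five_hexShape_tail hB (by omega) le_rfl]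
    omega

/-- **Family R2** (`k = 4`, `j = s − 2`, `s = r + 1 ≥ 3`): `N = a_n − 2`.  The balanced hexagon minus a
two-label row end (one `5`-valent label) against the same hexagon minus a row end of one label and the
opposite vertex (two `5`-valent labels). [cite: LucaFriesecke2017, Theorem 1.1 and §2 p0003–p0005] -/
theorem not_isUniqueUpToRigidMotion_pred_pred (m : ℕ) (hm : 1 ≤ m) :
    ¬ IsUniqueUpToRigidMotion (3 * (m + 2) ^ 2 + 3 * (m + 2) + 1 + (m + 2 + 1) * 4 + m) := by
  have hA : HexParams (2 * m + 5) (2 * m + 6) (m + 2) (3 * m + 8) 2 0 :=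
    ⟨by omega, by omega, by omega, by omega, by omega, by omega, by omega, by omega, by omega, by omega⟩
  have hB : HexParams (2 * m + 5) (2 * m + 6) (m + 2) (3 * m + 8) 1 1 :=
    ⟨by omega, by omega, by omega, by omega, by omega, by omega, by omega, by omega, by omega, by omega⟩
  have cA := card_and_lineCount_hexShape (N := 3 * m ^ 2 + 20 * m + 31) (ℓ := 6 * m + 20) (t := m + 3)
    hA (by omega) (by omega) (by omega) (by ring) (by omega)
  have cB := card_and_lineCount_hexShape (N := 3 * m ^ 2 + 20 * m + 31) (ℓ := 6 * m + 20) (t := m + 3)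
    hB (by omega) (by omega) (by omega) (by ring) (by omega)
  rw [show 3 * (m + 2) ^ 2 + 3 * (m + 2) + 1 + (m + 2 + 1) * 4 + m = 3 * m ^ 2 + 20 * m + 31 by ring]
  refine not_isUniqueUpToRigidMotion_of_pair cA cB (ceil_sqrt_eq_of (by omega) (by nlinarith) (by nlinarith)) ?_
  rw [card_degree_five_hexShape_tail hA (by omega) (by omega),
    card_degree_five_hexShape_tail_vertex hB (by omega) le_rfl]
  omega

/-- **Family R3** (`k = 5`, `1 ≤ j ≤ s`, `s ≥ 3`): `N = #H_{s+1} − (s+1−j)`.  For `j = s`: the hexagon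
`H_{s+1}` minus a vertex against the full unbalanced hexagon; for `j < s`: `H_{s+1}` minus a row end of
`s+1−j` labels (one `5`-valent label) against `H_{s+1}` minus a row end of `s−j` labels and the opposite
vertex (two `5`-valent labels). [cite: LucaFriesecke2017, Theorem 1.1 and §2 p0003–p0005] -/
theorem not_isUniqueUpToRigidMotion_five (s j : ℕ) (hs : 3 ≤ s) (hj1 : 1 ≤ j) (hjs : j ≤ s) :
    ¬ IsUniqueUpToRigidMotion (3 * s ^ 2 + 3 * s + 1 + (s + 1) * 5 + j) := by
  obtain ⟨w, rfl⟩ : ∃ w, s = j + w := ⟨s - j, by omega⟩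
  have hceil : ⌈Real.sqrt (12 * ((3 * (j + w) ^ 2 + 3 * (j + w) + 1 + (j + w + 1) * 5 + j : ℕ) : ℝ) - 3)⌉ =
      ((6 * (j + w) + 9 : ℕ) : ℤ) :=
    ceil_sqrt_eq_of (by omega) (by nlinarith) (by nlinarith)
  rcases Nat.eq_zero_or_pos w with rfl | hw
  · -- j = s: `H_{s+1}` minus a vertex against the full unbalanced hexagon
    simp only [add_zero] at hceil ⊢
    have hA : HexParams (2 * j + 2) (2 * j + 2) (j + 1) (3 * j + 3) 1 0 :=
      ⟨by omega, by omega, by omega, by omega, by omega, by omega, by omega, by omega, by omega, by omega⟩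
    have hB : HexParams (2 * j + 1) (2 * j + 3) (j + 1) (3 * j + 3) 0 0 :=
      ⟨by omega, by omega, by omega, by omega, by omega, by omega, by omega, by omega, by omega, by omega⟩
    have cA := card_and_lineCount_hexShape (N := 3 * j ^ 2 + 3 * j + 1 + (j + 1) * 5 + j)
      (ℓ := 6 * j + 9) (t := j + 1) hA (by omega) (by omega) (by omega) (by ring) (by omega)
    have cB := card_and_lineCount_hexShape (N := 3 * j ^ 2 + 3 * j + 1 + (j + 1) * 5 + j)
      (ℓ := 6 * j + 9) (t := j + 1) hB (by omega) (by omega) (by omega) (by ring) (by omega)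
    refine not_isUniqueUpToRigidMotion_of_pair cA cB hceil ?_
    rw [card_degree_five_hexShape_tail hA (by omega) le_rfl, card_degree_five_hexShape_zero]
    omega
  · -- j < s: two clippings of `H_{s+1}`
    have hA : HexParams (2 * (j + w) + 2) (2 * (j + w) + 2) (j + w + 1) (3 * (j + w) + 3) (w + 1) 0 :=
      ⟨by omega, by omega, by omega, by omega, by omega, by omega, by omega, by omega, by omega, by omega⟩
    have hB : HexParams (2 * (j + w) + 2) (2 * (j + w) + 2) (j + w + 1) (3 * (j + w) + 3) w 1 :=
      ⟨by omega, by omega, by omega, by omega, by omega, by omega, by omega, by omega, by omega, by omega⟩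
    have cA := card_and_lineCount_hexShape (N := 3 * (j + w) ^ 2 + 3 * (j + w) + 1 + (j + w + 1) * 5 + j)
      (ℓ := 6 * (j + w) + 9) (t := j + w + 1) hA (by omega) (by omega) (by omega) (by ring) (by omega)
    have cB := card_and_lineCount_hexShape (N := 3 * (j + w) ^ 2 + 3 * (j + w) + 1 + (j + w + 1) * 5 + j)
      (ℓ := 6 * (j + w) + 9) (t := j + w + 1) hB (by omega) (by omega) (by omega) (by ring) (by omega)
    refine not_isUniqueUpToRigidMotion_of_pair cA cB hceil ?_
    rw [card_degree_five_hexShape_tail hA (by omega) (by omega),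
      card_degree_five_hexShape_tail_vertex hB (by omega) hw]
    omega

/-! ## §7 De Luca–Friesecke's Theorem 1.1 -/

/-- Every `N ≥ 1` is `3s² + 3s + 1 + (s+1)k + j` with `k ≤ 5`, `j ≤ s` (hexagonal shells). [folklore] -/
private theorem exists_shell_decomposition {N : ℕ} (hN : 1 ≤ N) :
    ∃ s k j : ℕ, k ≤ 5 ∧ j ≤ s ∧ N = 3 * s ^ 2 + 3 * s + 1 + (s + 1) * k + j := by
  induction N, hN using Nat.le_induction with
  | base => exact ⟨0, 0, 0, by omega, le_rfl, by norm_num⟩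
  | succ N hN ih =>
    obtain ⟨s, k, j, hk, hj, rfl⟩ := ih
    rcases Nat.lt_or_ge j s with hjs | hsj
    · exact ⟨s, k, j + 1, hk, hjs, by ring⟩
    · rcases Nat.lt_or_ge k 5 with hk5 | h5k
      · exact ⟨s, k + 1, 0, hk5, Nat.zero_le _, by rw [le_antisymm hj hsj]; ring⟩
      · exact ⟨s + 1, 0, 0, by omega, Nat.zero_le _, by rw [le_antisymm hj hsj, le_antisymm hk h5k]; ring⟩

/-- **De Luca–Friesecke 2017, Theorem 1.1 (PROVED): for `N ≥ 1` the Heitmann–Radin minimizer is unique up to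
rotation and translation iff `N = 3s² + 3s + 1` or `N = 3s² + 3s + 1 + (s+1)k + s`, `k ∈ {0,…,4}`.**
Discharges the named fact `LucaFriesecke2017_uniqueness`.  'If': `isUniqueUpToRigidMotion_of_isUniqueParticleNumber`
(the Harborth–De Luca–Friesecke bond-graph argument, `StickyDiscUniqueGroundStates`).  'Only if': `N ≤ 38` by
`uniqueness_iff_of_le_thirtyeight`; for `N ≥ 39` write `N = 3s²+3s+1+(s+1)k+j` (`s ≥ 3`, `k ≤ 5`, `j ≤ s`) and use the
explicit pairs of maximal configurations with different degree statistics: `j = 0 < k` (Harborth spiral vs. corner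
removed, `not_isUniqueUpToRigidMotion_hexagonal_add_mul`), `k = 0, j = 1` (`…_hexagonal_add_one`), `1 ≤ j ≤ s−2`
(`…_hexagonal_add_mul_add`, except `k = 4, j = s−2`: `not_isUniqueUpToRigidMotion_pred_pred`), `j = s−1`
(`not_isUniqueUpToRigidMotion_pred`), `k = 5, j ≥ 1` (`not_isUniqueUpToRigidMotion_five`).
[cite: LucaFriesecke2017, Theorem 1.1 (p0003) and §2 (p0005)] -/
theorem LucaFriesecke2017_uniqueness_holds : LucaFriesecke2017_uniqueness := by
  intro N hN
  by_cases h38 : N ≤ 38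
  · exact uniqueness_iff_of_le_thirtyeight hN h38
  refine ⟨fun hU => ?_, isUniqueUpToRigidMotion_of_isUniqueParticleNumber⟩
  obtain ⟨s, k, j, hk, hj, rfl⟩ := exists_shell_decomposition hN
  have hs : 3 ≤ s := by
    by_contra hs
    push Not at hs h38
    have := Nat.mul_le_mul_left (s + 1) hk
    nlinarith
  rcases Nat.eq_zero_or_pos j with rfl | hj1
  · rcases Nat.eq_zero_or_pos k with rfl | hk1
    · exact Or.inl ⟨s, by ring⟩
    · exact absurd (by simpa using hU) (not_isUniqueUpToRigidMotion_hexagonal_add_mul s k (by omega) hk1 hk)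
  rcases (show k = 5 ∨ k ≤ 4 by omega) with rfl | hk4
  · exact absurd hU (not_isUniqueUpToRigidMotion_five s j hs hj1 hj)
  rcases (show j = s ∨ j + 1 = s ∨ j + 2 ≤ s by omega) with rfl | rfl | hj2
  · exact Or.inr ⟨j, k, hk4, rfl⟩
  · exact absurd hU (not_isUniqueUpToRigidMotion_pred j k (by omega) hk4)
  rcases (show (k = 4 ∧ j + 2 = s) ∨ (k ≤ 3 ∨ j + 3 ≤ s) by omega) with ⟨rfl, rfl⟩ | hk3
  · exact absurd hU (not_isUniqueUpToRigidMotion_pred_pred j hj1)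
  rcases (show (k = 0 ∧ j = 1) ∨ (k ≠ 0 ∨ 2 ≤ j) by omega) with ⟨rfl, rfl⟩ | hkj
  · have h := not_isUniqueUpToRigidMotion_hexagonal_add_one s (by omega)
    rw [show 3 * s ^ 2 + 3 * s + 2 = 3 * s ^ 2 + 3 * s + 1 + (s + 1) * 0 + 1 by ring] at h
    exact absurd hU h
  · exact absurd hU (not_isUniqueUpToRigidMotion_hexagonal_add_mul_add s k j hs hk4 hj1 hj2 hkj hk3)

end Literature.MathematicalPhysics.StatisticalMechanics.LucaFriesecke2017

end
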